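import Summits.Schanuel.Schanuel.Theorems.RootDecomp1KDescent06

/-!
# RootDecomp1KCubicDescent — lens 1, generation 59, NODE 20 «3-DESCENT ON THE K-LINE» (Chevalley–Weil through the ℚ-rational 3-torsion μ₃-cover, Runge function w + 2 upstairs; RULE K-R50 (iii) payable clause; CLAIM L2763, PRICE L2766, K-R51) — part 1 (RootDecomp1KCubicDescent01): §0 helpers, §1 the family CB, §2 the level equation in integers

(lens-1 g59 NODE 20 HOME kernel K = HOME/decomp-schanuel-lens-1/g59/Cubic.lean eea76fbb…, 1125 l, imports tree …RootDecomp1KDescent06 ONLY = the port of node 19 (no Literature import, no fact def, no private, no set_option, no structure, no axiom / instance / sorry / native_decide); Probe / Ctrl0 / Ctrl + NODE-g59.md + SHA256SUMS; CLAIM L2763, writer g30 pre-kernel re-verification L2769, crit g10 EX-ANTE PRICE L2766 (ONE THEOREM ×1 for (A) descent lemma + (B) the uniform theorem thinFibreAt_CB over ℤ⁴ + (C) class/territory CJ j JOINTLY iff CHECKLIST K-g59 (1)–(10); RULE K-R51 pre-announced), census LIVENESS-v12/v13/v14 L2765/L2767/L2771 (node-20 rows; keys cub3 / frob / tors / jroot;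 of record L2766/L2768/L2772), NODE L2775, critic VERDICT L2777 (crit g10): CLEARED — THEOREM ×1 for (A) the descent lemma + (B) the uniform theorem thinFibreAt_CB over ℤ⁴ + (C) class/territory CJ j JOINTLY under RULE K-R50 (iii), CHECKLIST K-g59 (1)–(10) met, rung 0; LABEL OF RECORD: literature = VARIANT of a KNOWN TOOL (Chevalley–Weil through a rational-3-torsion μ₃-cover + Runge upstairs: Schaefer 1998 / Levin 2008 Thm 6 made explicit); RULE K-R51 FIXED (toolkit of record ∪= DESCENT IN GENERAL — every further descent-built member / family / torsion order ℓ / engine ×0-as-record; OPEN TERRITORY at m₀ = 2 := K-R49 territory ∧ NO ℚ-rational descent datum, k = 2 certificate = census LIVENESS keys j2rat none ∧ jroot(ℓ) none for ℓ ∈ {2,3,5,7,11} ∧ tors; standing witness W4 certified for ℓ ≤ 11; UNCONDITIONAL PART ∪= CB(ℤ⁴) at ThinFibreAt m₀ ≥ 2); TALLY lens-1 ×17 + THEOREM ×19; PORT GO exactly as census STAGING NOTES 10/10b L2774/L2776 (lens concurred L2775) with the edits (a) + (b) + (c) SANCTIONED. Port by census-1 gen 23 as `RootDecomp1KCubicDescent01–05`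 (`--supports stmt-Schanuel-33364`; no census credit): 01 = §0 helpers, §1 the family `CB h₁ h₀ l₁ l₀ = xPolyP 2 (cbC …)` (`cbH`, `cbL`, `cbC`, `bev_CB`), §2 the level equation in integers; 02 = §3 THE DESCENT LEMMA (pure ℤ-arithmetic, six named steps: `dvd_p_of_level`, `dvd_H_of_level`, `even_h_of_level`, `isCoprime_twist`, `eq_cube_of_coprime_cb`, `two_pow_dvd_add_of_cube_cb`; `descent_cb`); 03 = §4 THE ENGINE **`thinFibreAt_CB (h₁ h₀ l₁ l₀ : ℤ) (hm : 2 ≤ m₀) : ThinFibreAt m₀ (CB h₁ h₀ l₁ l₀)`** HYPOTHESIS-FREE, uniform over ℤ⁴ (the Runge function on the μ₃-cover is w + 2); 04 = §5 class data (`xDisc`, `CJ j := CB 0 5 5 (10 + 600 j)`, `cjQ`, `cjD`) and §6 the RABIN certificate mod 3 + Gauss: `Irreducible ((xDisc (CJ j)).map ℚ)` uniformly in j; 05 = §7 TERRITORY (section Territory): `CJ_territory`, named members CJ0 / CJ1. PORT EDITS: (a) 33 one-line docstrings quoting the signature on the undocumented decls (`cbC_two` / `cbC_one` / `cbC_zero`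 / `cbC_of_gt`, `aeval_cbH`, `aeval_cbL`, `monic_cbH`, `cbH_ne_zero`, `natDegree_cjD`, `coeff_cjD_six/five/four`, `leadingCoeff_cjD`, `ra2` … `re3`, `natDegree_cbH`, `natDegree_cbC_zero`, `natDegree_cbC_one_055`, `coeff_zero_cbC_two_055`, `monic_cjQ`, `natDegree_cjQ`, `cjQ_ne_zero`, `coeff_four_cjQ`, `cbC_two_055_ne_zero`, `bzB`, `bzM`, `bzW`, `thinFibreAt_two_CJ1`, `CJ0_territory`); (b) PRIVATISATION ×2 of the §0 one-liners that the head dry-run BOUNCED as dedup.landed twins of importable out-of-cone declarations — `isCoprime_num_den_cb` (≡ `Literature.NumberTheory.DiophantineApproximation.isCoprime_num_den`) and `odd_psNumer_cb` (≡ `RootDecomp1KCollarCell.odd_psNumer_two`, CollarCell02 = +53 modules) — with file-local private copies in 03 where §4's `thinFibreAt_CB` uses them; (c) K's import line moved ABOVE its 4-line copyright comment (the part-01 provenance module docstring must follow the import; comment kept verbatim); nothing else (no deletion, no replacement of a statement, no import added, no set_option; K's `@[simp]` kept); provenance doc blocks + continuation headers = K's own open-lines; statements and proofs VERBATIM. Rung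 0 — nothing here proves Schanuel, 33364, 33363, 31077 or ThinFibre 2; everything HYPOTHESIS-FREE.)
-/

/-
Copyright (c) 2026. All rights reserved.
Released under Apache 2.0 license as described in the file LICENSE.
-/

/-!
# RootDecomp1KCubicDescent — lens 1, generation 59, NODE 20 «3-DESCENT ON THE K-LINE» (the cubic-descent family `CB`)

THE FAMILY.  Four integer parameters `h₁ h₀ l₁ l₀`, `H := Y² + h₁Y + h₀` (MONIC), `L := l₁Y + l₀`:

  `CB(h₁,h₀,l₁,l₀) := (H² + 4L)·x² + (4 − L·H)·x − H = xPolyP 2 c`,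
  `c₂ = Q := H² + 4L` (monic quartic), `c₁ = 4 − L·H`, `c₀ = −H`.

THREE IDENTITIES carry the node: `Δ_x := c₁² − 4c₀c₂ = G² + 4H³` with `G := L·H + 4` (a ℚ-rational
3-torsion datum on the Jacobian of `y² = Δ_x`); `−c₁ − G = −8 = (−2)³` (the value of `y − G` at the
pole places is a rational cube); and the level equation below.

* §0 helpers · §1 the family and `bev` · §2 the level equation in integers
* §3 THE DESCENT LEMMA (pure `ℤ`-arithmetic): at a level point the twist class of the `μ₃`-cover
  `w³ = y − G` is trivial — odd primes are killed by `G = LH + 4` with `H` monic, the prime `2` by the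
  cube `−8` — and the integer `e + d` (the Runge function `w + 2` read 2-adically) is a multiple of
  `2^{N!−1}`: `descent_cb`, composed of the SIX NAMED STEPS `dvd_p_of_level` (d ∣ p, a genuine gcd argument),
  `dvd_H_of_level` (p′ ∣ H̃), `even_h_of_level` (parity), `isCoprime_twist` (odd primes), `eq_cube_of_coprime_cb`
  (cube extraction), `two_pow_dvd_add_of_cube_cb` (the 2-adic digits `2^{k+2} ∣ e + d`).
* §4 THE ENGINE, hypothesis-free and uniform over `ℤ⁴`:
  `thinFibreAt_CB (h₁ h₀ l₁ l₀ : ℤ) (hm : 2 ≤ m₀) : ThinFibreAt m₀ (CB h₁ h₀ l₁ l₀)`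
  (`|e + d|` two ways: `≥ 2^{N!−1}` vs `≤ (B(C)+1)·den r`; then the tree's `runge_arith`).
* §5 class data: `xDisc`, the sub-family `CJ j := CB(0,5,5,10+600j)`, its coefficients.
* §6 irreducibility of `Δ_x(CJ j)` over `ℚ` by a RABIN certificate mod 3 + Gauss's lemma.
* §7 the territory conjunction `CJ_territory`, injectivity.

HONESTY.  RUNG 0 of the ladder.  Reach = the K-line residual `ThinFibreAt m₀` (`m₀ ≥ 2`) for the family
`CB(ℤ⁴) ⊃ CJ(ℕ)` — of which ONLY the `CJ`-type members are K-R50 territory (the engine also re-proves decided /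
non-frontier members such as `CB(0,0,0,0)`, reducible top, or `CB(1,−3,7,2)`, rootless top: fine, no credit);
NOT `LevelFinite` (the descent bounds `den r ∣ p_N < 2^{N!+1}` only), NOT `m₀ = 1` (`runge_arith` needs `2 ≤ m₀`).
The standing witness `W4 = x²(Y⁴−17) + x(Y³+1) + (Y+2)` is NOT reached and CANNOT be by this lever (its Jacobian
has no rational 3-torsion: critic L2766, `#J_W4(𝔽₃) = 23`, `#J_W4(𝔽₅) = 39`).  `ThinFibre 2`, the route cruxes
33364 / 31077 / 33363 / 31987 and `Schanuel` are NOT moved; NO binder is proved (`SepTopAt 2 (CJ j)` holds — the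
conditional class of node 11 — and `PadicSubspace` is BYPASSED, not proved).  The family was CONSTRUCTED so that the
Jacobian of `y² = Δ_x` carries a ℚ-rational 3-torsion class (`Δ_x = G² + 4H³`) whose `μ₃`-cover `w³ = y − G` has a
totally split fibre over the pole orbit (`−c₁ − G = −8` a cube).  No hypothesis def, no certificate structure, no
`native_decide`; standard axioms only.
-/

noncomputable section

namespace Summit.Schanuel.Schanuel.Theorems.RootDecomp1KCubicDescent

open Polynomial LiouvilleNumber
open scoped Nat
open Summit.Schanuel.Schanuel.Theorems.RootDecomp1KTwoBaseCell (psNumer partialSum_eq_psNumer_div coprime_psNumer)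
open Summit.Schanuel.Schanuel.Theorems.RootDecomp1KDegreeLadder
open Summit.Schanuel.Schanuel.Theorems.RootDecomp1KXLinear
open Summit.Schanuel.Schanuel.Theorems.RootDecomp1KXLinearII
open Summit.Schanuel.Schanuel.Theorems.RootDecomp1KXTop
open Summit.Schanuel.Schanuel.Theorems.RootDecomp1KXAll
open Summit.Schanuel.Schanuel.Theorems.RootDecomp1KLevelFinite
open Summit.Schanuel.Schanuel.Theorems.RootDecomp1KThueMahler
open Summit.Schanuel.Schanuel.Theorems.RootDecomp1KParamThueMahler
open Summit.Schanuel.Schanuel.Theorems.RootDecomp1KLocalExponent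
open Summit.Schanuel.Schanuel.Theorems.RootDecomp1KIntegrality (GaussAt gaussAt_xPolyP_iff)
open Summit.Schanuel.Schanuel.Theorems.RootDecomp1KSubspaceBranch (SepTopAt)
open Summit.Schanuel.Schanuel.Theorems.RootDecomp1KRunge
open Summit.Schanuel.Schanuel.Theorems.RootDecomp1KDescent

/-! ### §0 Helpers -/

/-- `num r ⊥ den r`. -/
private theorem isCoprime_num_den_cb (r : ℚ) : IsCoprime r.num (r.den : ℤ) := by
  rw [Int.isCoprime_iff_gcd_eq_one]
  have := r.reduced
  simpa [Int.gcd] using this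

/-- `p_N` is odd (`N ≥ 2`). -/
private theorem odd_psNumer_cb {N : ℕ} (hN : 2 ≤ N) : Odd ((psNumer 2 N : ℕ) : ℤ) := by
  have h := coprime_psNumer 2 hN
  have h2 : ¬ 2 ∣ psNumer 2 N := by
    intro hd
    have := Nat.Coprime.eq_one_of_dvd (Nat.Coprime.symm h) hd
    omega
  rw [Int.odd_iff]
  omega

/-- `1/2 ≤ s_N` (the `i = 0` term of the partial sum is `1/2`). -/
theorem half_le_partialSum_cb (N : ℕ) : (1 : ℝ) / 2 ≤ partialSum 2 N := by
  unfold partialSum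
  have h := Finset.single_le_sum (f := fun i : ℕ => 1 / (2 : ℝ) ^ i !) (s := Finset.range (N + 1))
    (fun i _ => by positivity) (Finset.mem_range.mpr (Nat.succ_pos N))
  simpa using h

/-- an odd integer is coprime to `2`. -/
theorem isCoprime_two_of_odd_cb {n : ℤ} (hn : Odd n) : IsCoprime 2 n := by
  obtain ⟨t, rfl⟩ := hn
  exact ⟨-t, 1, by ring⟩

/-! ### §1 The family `CB(h₁,h₀,l₁,l₀) = (H²+4L)·x² + (4 − LH)·x − H` -/

/-- [datum] `H := Y² + h₁Y + h₀` (monic). -/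
def cbH (h₁ h₀ : ℤ) : ℤ[X] := X ^ 2 + C h₁ * X + C h₀

/-- [datum] `L := l₁Y + l₀`. -/
def cbL (l₁ l₀ : ℤ) : ℤ[X] := C l₁ * X + C l₀

/-- [datum] the `x`-coefficients: `c₂ = H² + 4L`, `c₁ = 4 − L·H`, `c₀ = −H`. -/
def cbC (h₁ h₀ l₁ l₀ : ℤ) : ℕ → ℤ[X] := fun j =>
  if j = 2 then cbH h₁ h₀ ^ 2 + 4 * cbL l₁ l₀
  else if j = 1 then 4 - cbL l₁ l₀ * cbH h₁ h₀
  else if j = 0 then -cbH h₁ h₀ else 0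

/-- [datum] **the cubic-descent family** `CB(h₁,h₀,l₁,l₀) := (H²+4L)·x² + (4 − L·H)·x − H`. -/
def CB (h₁ h₀ l₁ l₀ : ℤ) : ℤ[X][X] := xPolyP 2 (cbC h₁ h₀ l₁ l₀)

/-- `(h₁ h₀ l₁ l₀ : ℤ) : cbC h₁ h₀ l₁ l₀ 2 = cbH h₁ h₀ ^ 2 + 4 * cbL l₁ l₀`. -/
@[simp] theorem cbC_two (h₁ h₀ l₁ l₀ : ℤ) : cbC h₁ h₀ l₁ l₀ 2 = cbH h₁ h₀ ^ 2 + 4 * cbL l₁ l₀ := by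
  simp [cbC]
/-- `(h₁ h₀ l₁ l₀ : ℤ) : cbC h₁ h₀ l₁ l₀ 1 = 4 - cbL l₁ l₀ * cbH h₁ h₀`. -/
@[simp] theorem cbC_one (h₁ h₀ l₁ l₀ : ℤ) : cbC h₁ h₀ l₁ l₀ 1 = 4 - cbL l₁ l₀ * cbH h₁ h₀ := by
  simp [cbC]
/-- `(h₁ h₀ l₁ l₀ : ℤ) : cbC h₁ h₀ l₁ l₀ 0 = -cbH h₁ h₀`. -/
@[simp] theorem cbC_zero (h₁ h₀ l₁ l₀ : ℤ) : cbC h₁ h₀ l₁ l₀ 0 = -cbH h₁ h₀ := by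
  simp [cbC]
/-- `(h₁ h₀ l₁ l₀ : ℤ) {j : ℕ} (hj : 2 < j) : cbC h₁ h₀ l₁ l₀ j = 0`. -/
theorem cbC_of_gt (h₁ h₀ l₁ l₀ : ℤ) {j : ℕ} (hj : 2 < j) : cbC h₁ h₀ l₁ l₀ j = 0 := by
  simp [cbC, show j ≠ 2 by omega, show j ≠ 1 by omega, show j ≠ 0 by omega]

/-- `{R : Type*} [CommRing R] [Algebra ℤ R] (h₁ h₀ : ℤ) (y : R) : aeval y (cbH h₁ h₀) = y ^ 2 + (h₁ : R) * y + (h₀ : R)`. -/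
@[simp] theorem aeval_cbH {R : Type*} [CommRing R] [Algebra ℤ R] (h₁ h₀ : ℤ) (y : R) :
    aeval y (cbH h₁ h₀) = y ^ 2 + (h₁ : R) * y + (h₀ : R) := by
  simp [cbH]

/-- `{R : Type*} [CommRing R] [Algebra ℤ R] (l₁ l₀ : ℤ) (y : R) : aeval y (cbL l₁ l₀) = (l₁ : R) * y + (l₀ : R)`. -/
@[simp] theorem aeval_cbL {R : Type*} [CommRing R] [Algebra ℤ R] (l₁ l₀ : ℤ) (y : R) :
    aeval y (cbL l₁ l₀) = (l₁ : R) * y + (l₀ : R) := by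
  simp [cbL]

/-- THE IDENTITY `Δ_x = c₁² − 4c₀c₂ = G² + 4H³`, `G := L·H + 4` (the rational 3-torsion datum). -/
theorem disc_identity (h₁ h₀ l₁ l₀ : ℤ) :
    cbC h₁ h₀ l₁ l₀ 1 ^ 2 - 4 * cbC h₁ h₀ l₁ l₀ 0 * cbC h₁ h₀ l₁ l₀ 2 =
      (cbL l₁ l₀ * cbH h₁ h₀ + 4) ^ 2 + 4 * cbH h₁ h₀ ^ 3 := by
  simp only [cbC_two, cbC_one, cbC_zero]; ring

/-- THE IDENTITY `−c₁ − G = −8 = (−2)³` (the value of `y − G` at the pole places is a rational cube). -/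
theorem pole_value_identity (h₁ h₀ l₁ l₀ : ℤ) :
    -cbC h₁ h₀ l₁ l₀ 1 - (cbL l₁ l₀ * cbH h₁ h₀ + 4) = C ((-2) ^ 3) := by
  simp only [cbC_one, map_pow, map_neg]
  have : (C (2 : ℤ) : ℤ[X]) = 2 := rfl
  rw [this]; ring

/-- `CB` evaluated: `x²·(H(y)² + 4L(y)) + x·(4 − L(y)H(y)) − H(y)`. -/
theorem bev_CB (h₁ h₀ l₁ l₀ : ℤ) (x y : ℝ) :
    bev (CB h₁ h₀ l₁ l₀) x y =
      x ^ 2 * ((y ^ 2 + h₁ * y + h₀) ^ 2 + 4 * (l₁ * y + l₀)) +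
        x * (4 - (l₁ * y + l₀) * (y ^ 2 + h₁ * y + h₀)) - (y ^ 2 + h₁ * y + h₀) := by
  rw [CB, bev_xPolyP]
  simp [Finset.sum_range_succ, map_ofNat]
  ring

/-! ### §2 The level equation in integers -/

/-- **the level equation in integers** at a level point `(s_N, r)`, `s_N = p/q` (`q = 2^{N!}`), `r = u/d`:
`p²·(H̃² + 4d³L̃) + p·q·d·(4d³ − L̃·H̃) − q²·d²·H̃ = 0` with `H̃ = u² + d(h₁u + h₀d)`, `L̃ = l₁u + l₀d`
(`= q²·d⁴·CB(p/q, u/d)`). -/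
theorem level_eq_cb {h₁ h₀ l₁ l₀ : ℤ} {N : ℕ} {r : ℚ} (h : bev (CB h₁ h₀ l₁ l₀) (partialSum 2 N) r = 0) :
    ((psNumer 2 N : ℕ) : ℤ) ^ 2 * ((r.num ^ 2 + (r.den : ℤ) * (h₁ * r.num + h₀ * r.den)) ^ 2 +
        4 * (r.den : ℤ) ^ 3 * (l₁ * r.num + l₀ * r.den)) +
      ((psNumer 2 N : ℕ) : ℤ) * (2 : ℤ) ^ N ! * r.den *
        (4 * (r.den : ℤ) ^ 3 - (l₁ * r.num + l₀ * r.den) * (r.num ^ 2 + (r.den : ℤ) * (h₁ * r.num + h₀ * r.den))) -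
      ((2 : ℤ) ^ N !) ^ 2 * (r.den : ℤ) ^ 2 * (r.num ^ 2 + (r.den : ℤ) * (h₁ * r.num + h₀ * r.den)) = 0 := by
  rw [bev_CB, partialSum_two_eq_ratCast] at h
  set s : ℚ := (psNumer 2 N : ℚ) / 2 ^ N ! with hs
  have h1 : (((s ^ 2 * (((r : ℚ) ^ 2 + h₁ * r + h₀) ^ 2 + 4 * (l₁ * r + l₀)) +
      s * (4 - (l₁ * r + l₀) * ((r : ℚ) ^ 2 + h₁ * r + h₀)) - ((r : ℚ) ^ 2 + h₁ * r + h₀) : ℚ)) : ℝ) = 0 := by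
    push_cast at h ⊢; exact h
  have h2 : s ^ 2 * (((r : ℚ) ^ 2 + h₁ * r + h₀) ^ 2 + 4 * (l₁ * r + l₀)) +
      s * (4 - (l₁ * r + l₀) * ((r : ℚ) ^ 2 + h₁ * r + h₀)) - ((r : ℚ) ^ 2 + h₁ * r + h₀) = 0 := by
    exact_mod_cast h1
  have hq : (2 : ℚ) ^ N ! ≠ 0 := pow_ne_zero _ two_ne_zero
  have hd : (r.den : ℚ) ≠ 0 := by exact_mod_cast r.den_nz
  have hu : (r.num : ℚ) = r * r.den := (Rat.mul_den_eq_num r).symm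
  have key : ((((psNumer 2 N : ℕ) : ℤ) ^ 2 * ((r.num ^ 2 + (r.den : ℤ) * (h₁ * r.num + h₀ * r.den)) ^ 2 +
        4 * (r.den : ℤ) ^ 3 * (l₁ * r.num + l₀ * r.den)) +
      ((psNumer 2 N : ℕ) : ℤ) * (2 : ℤ) ^ N ! * r.den *
        (4 * (r.den : ℤ) ^ 3 - (l₁ * r.num + l₀ * r.den) * (r.num ^ 2 + (r.den : ℤ) * (h₁ * r.num + h₀ * r.den))) -
      ((2 : ℤ) ^ N !) ^ 2 * (r.den : ℤ) ^ 2 * (r.num ^ 2 + (r.den : ℤ) * (h₁ * r.num + h₀ * r.den)) : ℤ) : ℚ) =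
      ((2 : ℚ) ^ N !) ^ 2 * (r.den : ℚ) ^ 4 *
        (s ^ 2 * (((r : ℚ) ^ 2 + h₁ * r + h₀) ^ 2 + 4 * (l₁ * r + l₀)) +
          s * (4 - (l₁ * r + l₀) * ((r : ℚ) ^ 2 + h₁ * r + h₀)) - ((r : ℚ) ^ 2 + h₁ * r + h₀)) := by
    push_cast
    rw [hu, hs]
    field_simp
    ring
  rw [h2, mul_zero] at key
  exact_mod_cast key

end Summit.Schanuel.Schanuel.Theorems.RootDecomp1KCubicDescent

end
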